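import Mathlib
import Literature.Analysis.UnboundedOperators.DiagonalOperatorCompact
import Summits.NavierStokesRegularity.FluidComputer.SkewCutGalerkinLimit

/-!
# Skew-cut certificate: Galerkin brackets for a relatively bounded perturbation of an operator with
compact resolvent give a true eigenpair (SKEWCUT-CERT Thm 2 (ii), perturbed-resolvent form)
(instab4 g4 — implementation 2 of the skew-cut X0 certifier, cell `ns-blowup`, 2026-08-26)

HONEST FRAMING (human ruling D-0035): nothing here is a claim about Navier–Stokes blow-up.
WHAT THIS IS NOT: not NS evidence. MODEL lane: the consumer is the linear operator «NS linearised
about the forced ABC flow, compressed to symmetry class II», `L = L₀ + A` with `L₀ = νΔ` (diagonal in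
the Fourier–Craya basis, eigenvalues `−ν|k|² → −∞`) and `A v = P[U × (curl v − v)]` (first order,
banded). Companion of `SkewCutGalerkinLimit.lean` (g3: the compactness + limit-equation step with the
operator presented through ONE compact resolvent `S`). This file removes the remaining abstract
hypotheses of that step which are NOT model-specific:

* the resolvent of the perturbed operator. The free resolvent `S₀ = (x₀ − L₀)⁻¹` is compact (for a
  diagonal `L₀` this is the tree's `HilbertBasis.isCompactOperator_diagonalCLM_of_tendsto_zero`,
  symbol `1/(x₀ + ν|k|²) → 0` — Rellich); the first-order part enters ONLY through the bounded
  operator `T := A S₀` («relative boundedness at the base point `x₀`»); if `1 − T` is invertible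
  (e.g. `‖T‖ < 1`, which for the model is one explicit symbol/Schur bound
  `‖A (x₀ − νΔ)⁻¹‖ < 1` at a large real `x₀`) then `S := S₀ (1 − T)⁻¹ = (x₀ − L)⁻¹` is compact
  (`isCompactOperator_comp`), `D(L) = range S = range S₀`, and `L (S₀ w) = x₀ S₀ w − w + T w`;
* the projections: `P_n` = orthogonal (star) projections onto a monotone family of complete
  subspaces `U_n` with dense union (Mathlib `Submodule.starProjection_tendsto_self`,
  `isSelfAdjoint_starProjection`) — the certificate's cube truncations;
* the Galerkin relation in the form the finite sections deliver it: `v_n = S₀ u_n ∈ U_n`,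
  `u_n = (x₀ − L₀) v_n ∈ U_n` (automatic for truncations in an eigenbasis of `L₀`), and the SECTION
  EIGEN-EQUATION `P_n (L₀ v_n + A v_n) = x_n v_n`, i.e. `P_n (x₀ v_n − u_n + T u_n) = x_n v_n`,
  with `‖v_n‖ = 1` and the uniform GRAPH-NORM BOUND `‖u_n‖ = ‖(x₀ − L₀) v_n‖ ≤ C`
  (= the ENERGY/H²-BOUND line of the method note, instab3's lane).

Main statement `exists_eigenpair_of_galerkin_brackets`: under these hypotheses, if every section
eigenvalue `x_n` lies in `[a, c]`, then `L` has an eigenpair `L₀ v + A v = λ v`, `‖v‖ = 1`,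
`v = S₀ w ∈ D(L₀)`, with `λ ∈ [a, c]`, and `λ ∈ (a, c)` as soon as `a` and `c` are not eigenvalues
(SKEWCUT-CERT Thm 1 (a) at the bracket ends). `exists_eigenpair_of_galerkin_brackets_of_norm_lt_one`
is the `‖T‖ < 1` form; `exists_eigenpair_of_galerkin_brackets_diagonal` the form with
`S₀ = HilbertBasis.diagonalCLM d`, `d → 0`, and `U_n` = closed spans of basis vectors over an
exhausting monotone family of index sets (compactness and density discharged inside).

What stays model-specific after this file (METHOD-I4.md §7 K15): the bound `‖A (x₀ − νΔ)⁻¹‖ < 1`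
(symbol arithmetic), that the certifier's exact class-II matrices ARE the sections `P_n L P_n` in the
Fourier–Craya basis, the graph-norm bound `C`, injectivity at the bracket ends, and elliptic regularity
to `Literature.Analysis.FluidPDE.Torus.IsLinNSEigenvalue`.

Mathlib + `Literature.Analysis.UnboundedOperators.DiagonalOperatorCompact` + `SkewCutGalerkinLimit`;
no new definitions.
-/

namespace Summit.NavierStokesRegularity.FluidComputer.SkewCutGalerkinPerturbation

open Filter Topology Submodule
open scoped InnerProductSpace

variable {𝕜 H : Type*} [RCLike 𝕜] [NormedAddCommGroup H] [InnerProductSpace 𝕜 H] [CompleteSpace H]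

/-! ### The perturbed resolvent -/

omit [CompleteSpace H] in
/-- `S₀ ∘ B` is compact when `S₀` is (the perturbed resolvent `S = S₀ (1 − T)⁻¹` of `L = L₀ + A`,
`T = A S₀`, is compact with the free resolvent `S₀`). -/
theorem isCompactOperator_comp (S₀ : H →L[𝕜] H) (hS₀ : IsCompactOperator S₀) (B : H →L[𝕜] H) :
    IsCompactOperator (S₀ ∘L B) := by
  simpa only [ContinuousLinearMap.coe_comp] using hS₀.comp_clm B

omit [CompleteSpace H] in
/-- The eigen-equation of `L = L₀ + A` in resolvent coordinates: if `(1 − T) (B y) = y` and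
`S₀ (B ((x₀ − μ) • v)) = v`, then `w := B ((x₀ − μ) • v)` satisfies
`x₀ • S₀ w − w + T w = μ • S₀ w` (that is, `L₀ (S₀ w) + A (S₀ w) = μ • S₀ w` with
`L₀ S₀ w = x₀ S₀ w − w`, `A S₀ w = T w`). -/
theorem eigen_equation_of_rightInverse (S₀ T B : H →L[𝕜] H) (hBr : ∀ y, (1 - T) (B y) = y)
    (x₀ μ : 𝕜) (v : H) (hv : S₀ (B ((x₀ - μ) • v)) = v) :
    x₀ • S₀ (B ((x₀ - μ) • v)) - B ((x₀ - μ) • v) + T (B ((x₀ - μ) • v)) =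
      μ • S₀ (B ((x₀ - μ) • v)) := by
  have h := hBr ((x₀ - μ) • v)
  simp only [sub_apply, one_apply_eq_self] at h
  rw [hv]
  calc x₀ • v - B ((x₀ - μ) • v) + T (B ((x₀ - μ) • v))
        = x₀ • v - (B ((x₀ - μ) • v) - T (B ((x₀ - μ) • v))) := by abel
    _ = μ • v := by rw [h, sub_smul]; abel

/-! ### Galerkin brackets ⇒ eigenpair -/

/-- **Galerkin brackets for `L = L₀ + A` give a true eigenpair (SKEWCUT-CERT Thm 2 (ii), perturbed
resolvent form).** `S₀` compact (free resolvent `(x₀ − L₀)⁻¹`), `T` bounded with `1 − T` invertible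
(`T = A S₀`; `x₀` in the resolvent set of `L`), `U_n` a monotone family of complete subspaces with
dense union and star projections `P_n`; data `u_n ∈ U_n` with `v_n := S₀ u_n ∈ U_n`, `‖v_n‖ = 1`,
`‖u_n‖ ≤ C`, and the section eigen-equations `P_n (x₀ v_n − u_n + T u_n) = x_n v_n` with `x_n ∈ [a, c]`.
Then there are `λ ∈ [a, c]` and `w` with `‖S₀ w‖ = 1` and `x₀ • S₀ w − w + T w = λ • S₀ w`
(an eigenpair `(λ, S₀ w)` of `L₀ + A`), and `λ ∈ (a, c)` if neither `a` nor `c` is an eigenvalue. -/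
theorem exists_eigenpair_of_galerkin_brackets
    (S₀ : H →L[𝕜] H) (hS₀ : IsCompactOperator S₀) (T : H →L[𝕜] H) (hT : IsUnit (1 - T))
    (U : ℕ → Submodule 𝕜 H) [∀ n, (U n).HasOrthogonalProjection] (hU : Monotone U)
    (hU' : ⊤ ≤ (⨆ n, U n).topologicalClosure)
    (u : ℕ → H) (hu : ∀ n, u n ∈ U n) (hv : ∀ n, S₀ (u n) ∈ U n)
    (hv1 : ∀ n, ‖S₀ (u n)‖ = 1) {C : ℝ} (hC : ∀ n, ‖u n‖ ≤ C)
    (x₀ : ℝ) (xs : ℕ → ℝ) {a c : ℝ} (hxs : ∀ n, xs n ∈ Set.Icc a c)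
    (hGal : ∀ n, (U n).starProjection ((x₀ : 𝕜) • S₀ (u n) - u n + T (u n)) =
      (xs n : 𝕜) • S₀ (u n)) :
    ∃ lam ∈ Set.Icc a c, ∃ w : H, ‖S₀ w‖ = 1 ∧
      (x₀ : 𝕜) • S₀ w - w + T w = (lam : 𝕜) • S₀ w ∧
      ((∀ w : H, (x₀ : 𝕜) • S₀ w - w + T w = (a : 𝕜) • S₀ w → S₀ w = 0) →
        (∀ w : H, (x₀ : 𝕜) • S₀ w - w + T w = (c : 𝕜) • S₀ w → S₀ w = 0) →
          lam ∈ Set.Ioo a c) := by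
  -- the two-sided inverse `B` of `1 - T`
  obtain ⟨uT, huT⟩ := hT
  set B : H →L[𝕜] H := ↑uT⁻¹ with hB
  have hBl : ∀ y, B ((1 - T) y) = y := fun y => by
    have h : (↑uT⁻¹ * ↑uT : H →L[𝕜] H) = 1 := uT.inv_mul
    rw [huT] at h
    simpa only [hB, mul_apply_eq_comp, one_apply_eq_self] using
      congrArg (fun F : H →L[𝕜] H => F y) h
  have hBr : ∀ y, (1 - T) (B y) = y := fun y => by
    have h : (↑uT * ↑uT⁻¹ : H →L[𝕜] H) = 1 := uT.mul_inv
    rw [huT] at h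
    simpa only [hB, mul_apply_eq_comp, one_apply_eq_self] using
      congrArg (fun F : H →L[𝕜] H => F y) h
  -- the perturbed resolvent `S = S₀ B` is compact
  set S : H →L[𝕜] H := S₀ ∘L B with hSdef
  have hS : IsCompactOperator S := isCompactOperator_comp S₀ hS₀ B
  -- the projections
  set P : ℕ → H →L[𝕜] H := fun n => (U n).starProjection with hP
  have hPsa : ∀ n, IsSelfAdjoint (P n) := fun n => isSelfAdjoint_starProjection (U n)
  have hPs : ∀ x : H, Tendsto (fun n => P n x) atTop (𝓝 x) := fun x =>
    Submodule.starProjection_tendsto_self U hU x hU'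
  -- the graph-norm data `w_n = (1 - T) u_n`, `S w_n = S₀ u_n = v_n`
  set w : ℕ → H := fun n => u n - T (u n) with hw
  have hw' : ∀ n, w n = (1 - T) (u n) := fun n => by
    simp only [hw, sub_apply, one_apply_eq_self]
  have hSw : ∀ n, S (w n) = S₀ (u n) := fun n => by
    rw [hw', hSdef, ContinuousLinearMap.comp_apply, hBl]
  have hwC : ∀ n, ‖w n‖ ≤ ‖(1 : H →L[𝕜] H) - T‖ * C := fun n => by
    rw [hw']
    exact ((1 - T).le_opNorm (u n)).trans (mul_le_mul_of_nonneg_left (hC n) (norm_nonneg _))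
  have hv1' : ∀ n, ‖S (w n)‖ = 1 := fun n => by rw [hSw]; exact hv1 n
  -- the Galerkin relation in the form of `SkewCutGalerkinLimit`
  have hGal' : ∀ n, P n (w n) = ((x₀ : 𝕜) - (xs n : 𝕜)) • S (w n) := fun n => by
    have hPu : P n (u n) = u n := starProjection_eq_self_iff.2 (hu n)
    have hPv : P n (S₀ (u n)) = S₀ (u n) := starProjection_eq_self_iff.2 (hv n)
    have h := hGal n
    rw [map_add, map_sub, map_smul] at h
    change (x₀ : 𝕜) • P n (S₀ (u n)) - P n (u n) + P n (T (u n)) = (xs n : 𝕜) • S₀ (u n) at h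
    rw [hPu, hPv] at h
    have h2 : P n (T (u n)) = (xs n : 𝕜) • S₀ (u n) - (x₀ : 𝕜) • S₀ (u n) + u n := by
      rw [← h]; abel
    rw [hSw, hw, map_sub, hPu, h2, sub_smul]
    abel
  -- the compactness + limit-equation step (g3)
  obtain ⟨lam, hlam, v, hv1'', hfix, hIoo⟩ :=
    SkewCutGalerkinLimit.galerkin_eigenpair_limit_Icc_ofReal S hS P hPsa hPs w hwC hv1' x₀ xs hxs
      hGal'
  -- read the fixed point back through `B`
  have hback : ∀ (μ : ℝ) (y : H), ((x₀ : 𝕜) - (μ : 𝕜)) • S y = y →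
      S₀ (B (((x₀ : 𝕜) - (μ : 𝕜)) • y)) = y := fun μ y hy => by
    rw [← ContinuousLinearMap.comp_apply, ← hSdef, map_smul, hy]
  refine ⟨lam, hlam, B (((x₀ : 𝕜) - (lam : 𝕜)) • v), ?_, ?_, fun ha hc => hIoo ?_ ?_⟩
  · rw [hback lam v hfix]; exact hv1''
  · exact eigen_equation_of_rightInverse S₀ T B hBr (x₀ : 𝕜) (lam : 𝕜) v (hback lam v hfix)
  · intro y hy
    have h := ha (B (((x₀ : 𝕜) - (a : 𝕜)) • y))
      (eigen_equation_of_rightInverse S₀ T B hBr (x₀ : 𝕜) (a : 𝕜) y (hback a y hy))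
    rwa [hback a y hy] at h
  · intro y hy
    have h := hc (B (((x₀ : 𝕜) - (c : 𝕜)) • y))
      (eigen_equation_of_rightInverse S₀ T B hBr (x₀ : 𝕜) (c : 𝕜) y (hback c y hy))
    rwa [hback c y hy] at h

/-- **The `‖T‖ < 1` form** (relative smallness of the first-order part at the base point:
`‖A (x₀ − L₀)⁻¹‖ < 1`, so `1 − T` is invertible by the Neumann series). -/
theorem exists_eigenpair_of_galerkin_brackets_of_norm_lt_one
    (S₀ : H →L[𝕜] H) (hS₀ : IsCompactOperator S₀) (T : H →L[𝕜] H) (hT : ‖T‖ < 1)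
    (U : ℕ → Submodule 𝕜 H) [∀ n, (U n).HasOrthogonalProjection] (hU : Monotone U)
    (hU' : ⊤ ≤ (⨆ n, U n).topologicalClosure)
    (u : ℕ → H) (hu : ∀ n, u n ∈ U n) (hv : ∀ n, S₀ (u n) ∈ U n)
    (hv1 : ∀ n, ‖S₀ (u n)‖ = 1) {C : ℝ} (hC : ∀ n, ‖u n‖ ≤ C)
    (x₀ : ℝ) (xs : ℕ → ℝ) {a c : ℝ} (hxs : ∀ n, xs n ∈ Set.Icc a c)
    (hGal : ∀ n, (U n).starProjection ((x₀ : 𝕜) • S₀ (u n) - u n + T (u n)) =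
      (xs n : 𝕜) • S₀ (u n)) :
    ∃ lam ∈ Set.Icc a c, ∃ w : H, ‖S₀ w‖ = 1 ∧
      (x₀ : 𝕜) • S₀ w - w + T w = (lam : 𝕜) • S₀ w ∧
      ((∀ w : H, (x₀ : 𝕜) • S₀ w - w + T w = (a : 𝕜) • S₀ w → S₀ w = 0) →
        (∀ w : H, (x₀ : 𝕜) • S₀ w - w + T w = (c : 𝕜) • S₀ w → S₀ w = 0) →
          lam ∈ Set.Ioo a c) :=
  exists_eigenpair_of_galerkin_brackets S₀ hS₀ T (isUnit_one_sub_of_norm_lt_one hT) U hU hU' u hu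
    hv hv1 hC x₀ xs hxs hGal


/-! ### The diagonal free part: `L₀ = diag(ℓ)` in a Hilbert basis (Rellich), cube truncations -/

section Diagonal

variable {ι : Type*} (b : HilbertBasis ι 𝕜 H)

omit [CompleteSpace H] in
/-- Closed spans of basis vectors over index sets that eventually contain every index have dense
union (the cube truncations `|k|_∞ ≤ n` exhaust the Fourier–Craya basis). -/
theorem top_le_closure_iSup_span (F : ℕ → Set ι) (hFex : ∀ i, ∃ n, i ∈ F n) :
    ⊤ ≤ (⨆ n, (span 𝕜 (b '' F n)).topologicalClosure).topologicalClosure := by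
  have h1 : span 𝕜 (Set.range (fun i => b i)) ≤ ⨆ n, (span 𝕜 (b '' F n)).topologicalClosure := by
    rw [span_le]
    rintro _ ⟨i, rfl⟩
    obtain ⟨n, hn⟩ := hFex i
    have hi : b i ∈ (span 𝕜 (b '' F n)).topologicalClosure :=
      (span 𝕜 (b '' F n)).le_topologicalClosure (subset_span ⟨i, hn, rfl⟩)
    exact (le_iSup (fun n => (span 𝕜 (b '' F n)).topologicalClosure) n) hi
  have h2 := Submodule.topologicalClosure_mono h1
  rwa [b.dense_span] at h2

omit [CompleteSpace H] in
/-- The family of closed spans over a monotone family of index sets is monotone. -/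
theorem monotone_closure_span {F : ℕ → Set ι} (hF : Monotone F) :
    Monotone fun n => (span 𝕜 (b '' F n)).topologicalClosure := fun _ _ hmn =>
  Submodule.topologicalClosure_mono (span_mono (Set.image_mono (hF hmn)))

omit [CompleteSpace H] in
/-- A bounded diagonal operator maps the closed span of any set of basis vectors into itself
(the truncations are spanned by eigenvectors of `L₀`, hence of `S₀ = (x₀ − L₀)⁻¹`). -/
theorem diagonalCLM_mem_closure_span (m : lp (fun _ : ι => 𝕜) ⊤) (F : Set ι) {x : H}
    (hx : x ∈ (span 𝕜 (b '' F)).topologicalClosure) :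
    b.diagonalCLM m x ∈ (span 𝕜 (b '' F)).topologicalClosure := by
  have hmap : Submodule.map (b.diagonalCLM m : H →ₗ[𝕜] H) (span 𝕜 (b '' F)) ≤ span 𝕜 (b '' F) := by
    rw [Submodule.map_span_le]
    rintro _ ⟨i, hi, rfl⟩
    change b.diagonalCLM m (b i) ∈ span 𝕜 (b '' F)
    rw [b.diagonalCLM_basis]
    exact smul_mem _ _ (subset_span ⟨i, hi, rfl⟩)
  rw [← SetLike.mem_coe, Submodule.topologicalClosure_coe] at hx ⊢
  refine map_mem_closure (b.diagonalCLM m).continuous hx fun y hy => ?_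
  exact hmap ⟨y, hy, rfl⟩

/-- **Diagonal form.** `S₀ = diag(d)` in a Hilbert basis with `d i → 0` (cofinite) — e.g.
`d i = 1/(x₀ + ν|k_i|²)`, the free resolvent of `νΔ`, compact by the tree's
`HilbertBasis.isCompactOperator_diagonalCLM_of_tendsto_zero` (Rellich) —, `‖T‖ < 1`, and the
truncations `U_n` = closed spans of the basis vectors indexed by a monotone exhausting family `F_n`.
Section eigen-equations `P_n (x₀ v_n − u_n + T u_n) = x_n v_n` (`v_n = S₀ u_n`, `u_n ∈ U_n`,
`‖v_n‖ = 1`, `‖u_n‖ ≤ C`) with `x_n ∈ [a, c]` give an eigenpair `x₀ S₀ w − w + T w = λ S₀ w`,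
`‖S₀ w‖ = 1`, `λ ∈ [a, c]` (`∈ (a, c)` if the ends are not eigenvalues). -/
theorem exists_eigenpair_of_galerkin_brackets_diagonal
    (d : lp (fun _ : ι => 𝕜) ⊤) (hd : Tendsto (fun i => ‖d i‖) cofinite (𝓝 0))
    (T : H →L[𝕜] H) (hT : ‖T‖ < 1)
    (F : ℕ → Set ι) (hF : Monotone F) (hFex : ∀ i, ∃ n, i ∈ F n)
    (u : ℕ → H) (hu : ∀ n, u n ∈ (span 𝕜 (b '' F n)).topologicalClosure)
    (hv1 : ∀ n, ‖b.diagonalCLM d (u n)‖ = 1) {C : ℝ} (hC : ∀ n, ‖u n‖ ≤ C)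
    (x₀ : ℝ) (xs : ℕ → ℝ) {a c : ℝ} (hxs : ∀ n, xs n ∈ Set.Icc a c)
    (hGal : ∀ n, (span 𝕜 (b '' F n)).topologicalClosure.starProjection
        ((x₀ : 𝕜) • b.diagonalCLM d (u n) - u n + T (u n)) = (xs n : 𝕜) • b.diagonalCLM d (u n)) :
    ∃ lam ∈ Set.Icc a c, ∃ w : H, ‖b.diagonalCLM d w‖ = 1 ∧
      (x₀ : 𝕜) • b.diagonalCLM d w - w + T w = (lam : 𝕜) • b.diagonalCLM d w ∧
      ((∀ w : H, (x₀ : 𝕜) • b.diagonalCLM d w - w + T w = (a : 𝕜) • b.diagonalCLM d w →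
          b.diagonalCLM d w = 0) →
        (∀ w : H, (x₀ : 𝕜) • b.diagonalCLM d w - w + T w = (c : 𝕜) • b.diagonalCLM d w →
          b.diagonalCLM d w = 0) → lam ∈ Set.Ioo a c) :=
  exists_eigenpair_of_galerkin_brackets_of_norm_lt_one (b.diagonalCLM d)
    (b.isCompactOperator_diagonalCLM_of_tendsto_zero d hd) T hT
    (fun n => (span 𝕜 (b '' F n)).topologicalClosure) (monotone_closure_span b hF)
    (top_le_closure_iSup_span b F hFex) u hu (fun n => diagonalCLM_mem_closure_span b d (F n) (hu n))
    hv1 hC x₀ xs hxs hGal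

omit [CompleteSpace H] in
/-- **Reading `S₀ = diag(d)` as the resolvent of the unbounded diagonal operator `L₀ = diag(ℓ)`.**
If `d i · (x₀ − ℓ i) = 1` for every `i` (so `d i = 1/(x₀ − ℓ i)`; for `L₀ = νΔ`, `ℓ i = −ν|k_i|²`),
then every `S₀ w` lies in the maximal domain of `diag(ℓ)` (`HilbertBasis.diagonalDomain`) and
`diag(ℓ) (S₀ w) = x₀ S₀ w − w`: the eigen-equation `x₀ S₀ w − w + T w = λ S₀ w` above IS
`L₀ v + A v = λ v` for `v = S₀ w`, `A v = T w`. -/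
theorem diagonalPMap_diagonalCLM (ℓ : ι → 𝕜) (x₀ : 𝕜) (d : lp (fun _ : ι => 𝕜) ⊤)
    (hd : ∀ i, d i * (x₀ - ℓ i) = 1) (w : H) :
    ∃ h : b.diagonalCLM d w ∈ b.diagonalDomain ℓ,
      b.diagonalPMap ℓ ⟨b.diagonalCLM d w, h⟩ = x₀ • b.diagonalCLM d w - w := by
  -- `ℓ i * d i = x₀ * d i - 1` is a bounded sequence
  have hkey : ∀ i, ℓ i * d i = x₀ * d i - 1 := fun i => by
    have := hd i
    linear_combination (-1 : 𝕜) * this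
  have hmem : b.diagonalCLM d w ∈ b.diagonalDomain ℓ := by
    rw [HilbertBasis.mem_diagonalDomain_iff]
    have h1 : Memℓp (fun i => (x₀ * d i - 1) * b.repr w i) 2 := by
      refine Memℓp.infty_mul_left ?_ (lp.memℓp (b.repr w))
      have hx : Memℓp (fun i => x₀ * d i) ⊤ := (lp.memℓp d).const_mul x₀
      have h1' : Memℓp (fun _ : ι => (1 : 𝕜)) ⊤ :=
        memℓp_infty ⟨1, by rintro _ ⟨i, rfl⟩; simp⟩
      simpa [Pi.sub_def] using hx.sub h1'
    refine (congrArg (fun f => Memℓp f 2) ?_).mp h1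
    funext i
    rw [b.diagonalCLM_apply_repr, ← mul_assoc, hkey]
  refine ⟨hmem, ?_⟩
  apply b.repr.injective
  ext i
  rw [b.repr_diagonalPMap_apply]
  change ℓ i * b.repr (b.diagonalCLM d w) i = b.repr (x₀ • b.diagonalCLM d w - w) i
  rw [map_sub, map_smul, lp.coeFn_sub, Pi.sub_apply, lp.coeFn_smul, Pi.smul_apply,
    b.diagonalCLM_apply_repr, smul_eq_mul, ← mul_assoc, hkey]
  ring

end Diagonal

end Summit.NavierStokesRegularity.FluidComputer.SkewCutGalerkinPerturbation
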